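import Mathlib
import HarnessLib
import Literature.MathematicalPhysics.StatisticalMechanics.TorusFRDGradCovLipschitz
import Literature.MathematicalPhysics.StatisticalMechanics.StepOperatorAKernelSub
import Literature.MathematicalPhysics.StatisticalMechanics.StepOperatorBLipschitzTorusFRD

/-!
# `‖H̃^{(q')} − H̃^{(q)}‖_{k,0} ≤ a_N·Σ|q'−q|·‖H‖ + b_N·‖K‖` for the step kernels of ONE `TorusFRD` package
# ([ABKM19] Lemma 12.6 (12.51)–(12.52) inputs combined: the extracted Hamiltonian is Lipschitz in `q`)

The extracted Hamiltonian `H̃ = nextH D H K = A_kH + B_kK` of the renormalisation step for the step data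
`abkmStepData L R k 𝒞s_q` (`𝒞s_q = (j ↦ 𝒞_{1+q,j})`) depends on `q` through `γ(𝒞_{1+q,k+1})` and `B_k^{(q)}`.
Combining the segment Lipschitz bound of `γ` (clause (iv), `ℓ = 1`: `abs_iterDiff_segment_sub_le`, here
along a general elliptic segment — **`abs_gradCov_segment_sub_le_of_torusFRD`**), the forward
`A`-difference (`hamNorm_nextH_kernel_sub_le`) and the `B`-difference (`hamNorm_opB_sub_of_torusFRD`):

* **`abs_gradCov_one_add_sub_le_of_torusFRD`** — `L^{kd}|γ_p(𝒞_{1+q',k+1}) − γ_p(𝒞_{1+q,k+1})| ≤ C''·Σ|q'−q|`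
  (`C'' = secondDiffConst (α ↦ C_{α,1})`) for symmetric `q, q'` with `Σ|q|, Σ|q'| ≤ ½`;
* **`hamNorm_nextH_sub_of_torusFRD`** — at the scale-`k` weights:
  `‖nextH (abkmStepData 𝒞s_{q'}) H K − nextH (abkmStepData 𝒞s_q) H K‖_{k,0}
     ≤ (C''·Σ|q'−q| / h²)·‖H‖_{k,0} + ‖opB(…q') K − opB(…q) K‖_{k,0}`
  (the second term is bounded by `hamNorm_opB_sub_of_torusFRD` after `hamNorm_succ_le`, or directly at scale `k`).

Everything is proved; no named fact.

## References
* S. Adams, S. Buchholz, R. Kotecký, S. Müller, arXiv:1910.13564, Theorem 6.1 (iv), Theorem 6.8, Lemma 12.6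
  [AdamsBuchholzKoteckyMuller2019].
-/

noncomputable section

namespace Literature.MathematicalPhysics.StatisticalMechanics.GradientRG

open scoped BigOperators
open Real Set Finset
open Literature.MathematicalPhysics.StatisticalMechanics.GradientFRD
  (fourierCoeff IsElliptic IsUnitSymm iterDiff supNorm conv ellOp InShell isElliptic_one)
open Literature.MathematicalPhysics.StatisticalMechanics.TorusPolymer (IsPolymer numBlocks blockOf boxCorner)
open Literature.Barriers.CriticalPhenomena.LongRangePhi4.Polymer (IsConn)
open Literature.MathematicalPhysics.QuantumFieldTheory

variable {d M : ℕ} [NeZero M]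

/-- **Segment Lipschitz bound of `γ_p(𝒞_{A,k})`** along an elliptic segment `A₀ + tB`, `t ∈ [0,T]`
(clause (iv) of `TorusFRD d` for every `A ∈ 𝓛(½,2)`, `ℓ = 1`, `|α| = 2`):
`L^{(k−1)d}·|γ_p(𝒞_{A₀+TB,k}) − γ_p(𝒞_{A₀,k})| ≤ secondDiffConst (α ↦ C_{α,1}) · T`.
[cite: AdamsBuchholzKoteckyMuller2019, Theorem 6.1 (iv)] -/
theorem abs_gradCov_segment_sub_le_of_torusFRD
    {𝒞 : Matrix (Fin d) (Fin d) ℝ → ℕ → (Fin d → ZMod M) → ℝ} {Cα : (Fin d → ℕ) → ℕ → ℝ} {L N n : ℕ}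
    (hiv : ∀ A : Matrix (Fin d) (Fin d) ℝ, IsElliptic (1 / 2 : ℝ) 2 A →
      ∀ k, 1 ≤ k → k ≤ N + 1 → ∀ B : Matrix (Fin d) (Fin d) ℝ, IsUnitSymm B →
        (∃ ε : ℝ, 0 < ε ∧ ∀ x : Fin d → ZMod M,
          ContDiffOn ℝ ⊤ (fun s : ℝ => 𝒞 (A + s • B) k x) (Set.Ioo (-ε) ε)) ∧
        ∀ α : Fin d → ℕ, ∑ i, α i ≤ n → ∀ ℓ : ℕ, ∀ x : Fin d → ZMod M,
          abs (iteratedDeriv ℓ (fun s : ℝ => iterDiff α (𝒞 (A + s • B) k) x) 0)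
            ≤ Cα α ℓ / (L : ℝ) ^ ((k - 1) * (d - 2 + ∑ i, α i)))
    (hd : 2 ≤ d) (hn : 2 ≤ n) (hL : 1 ≤ L)
    {A₀ B : Matrix (Fin d) (Fin d) ℝ} (hBu : IsUnitSymm B) {T : ℝ} (hT0 : 0 ≤ T)
    (hell : ∀ t ∈ Icc 0 T, IsElliptic (1 / 2 : ℝ) 2 (A₀ + t • B))
    {k : ℕ} (hk1 : 1 ≤ k) (hkN : k ≤ N + 1) (p : quadIndex d) :
    (L : ℝ) ^ ((k - 1) * d) *
        |gradCov (𝒞 (A₀ + T • B) k) p - gradCov (𝒞 A₀ k) p| ≤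
      secondDiffConst (fun α => Cα α 1) * T := by
  have hL0 : (0 : ℝ) < L := by exact_mod_cast (show 0 < L by omega)
  have hLpow : 0 < (L : ℝ) ^ ((k - 1) * d) := pow_pos hL0 _
  set θ : Fin d → ℕ := Pi.single p.1.2 1 + Pi.single p.1.1 1 with hθ
  set x₀ : Fin d → ZMod M := -(Pi.single p.1.2 1 : Fin d → ZMod M) with hx₀
  have hθ2 : ∑ i, θ i = 2 := by
    rw [hθ]; simp [Finset.sum_add_distrib, Pi.single_apply]
  have hgrad : ∀ 𝒦 : (Fin d → ZMod M) → ℝ, gradCov 𝒦 p = -iterDiff θ 𝒦 x₀ :=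
    fun 𝒦 => gradCov_eq_neg_iterDiff 𝒦 p
  have hdiff : ∀ t ∈ Icc 0 T, ∀ y, DifferentiableAt ℝ
      (fun s : ℝ => (fun A => 𝒞 A k) (A₀ + t • B + s • B) y) 0 := by
    intro t ht y
    obtain ⟨ε, hε, hcd⟩ := (hiv _ (hell t ht) k hk1 hkN B hBu).1
    have hmem : Set.Ioo (-ε) ε ∈ nhds (0 : ℝ) := Ioo_mem_nhds (by linarith) hε
    exact ((hcd y).differentiableOn (by simp)).differentiableAt hmem
  have hexp : (k - 1) * (d - 2 + ∑ i, θ i) = (k - 1) * d := by rw [hθ2, Nat.sub_add_cancel hd]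
  have hbound : ∀ t ∈ Icc 0 T,
      |iteratedDeriv 1 (fun s : ℝ => iterDiff θ ((fun A => 𝒞 A k) (A₀ + t • B + s • B)) x₀) 0| ≤
        Cα θ 1 / (L : ℝ) ^ ((k - 1) * d) := by
    intro t ht
    have h := (hiv _ (hell t ht) k hk1 hkN B hBu).2 θ (by omega) 1 x₀
    rw [hexp] at h
    exact h
  have hmv := abs_iterDiff_segment_sub_le (𝒦 := fun A => 𝒞 A k) (A₀ := A₀) hT0 θ x₀ hdiff hbound
  have hC : Cα θ 1 ≤ secondDiffConst fun α => Cα α 1 := le_secondDiffConst (fun α => Cα α 1) hθ2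
  rw [hgrad, hgrad, show -iterDiff θ (𝒞 (A₀ + T • B) k) x₀ - -iterDiff θ (𝒞 A₀ k) x₀ =
      -(iterDiff θ (𝒞 (A₀ + T • B) k) x₀ - iterDiff θ (𝒞 A₀ k) x₀) by ring, abs_neg]
  calc (L : ℝ) ^ ((k - 1) * d) * |iterDiff θ (𝒞 (A₀ + T • B) k) x₀ - iterDiff θ (𝒞 A₀ k) x₀|
      ≤ (L : ℝ) ^ ((k - 1) * d) * (Cα θ 1 / (L : ℝ) ^ ((k - 1) * d) * T) :=
        mul_le_mul_of_nonneg_left hmv hLpow.le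
    _ = Cα θ 1 * T := by field_simp
    _ ≤ secondDiffConst (fun α => Cα α 1) * T := mul_le_mul_of_nonneg_right hC hT0

/-- **`L^{kd}·|γ_p(𝒞_{1+q',k+1}) − γ_p(𝒞_{1+q,k+1})| ≤ secondDiffConst(C_{·,1}) · Σ|q'−q|`** for symmetric
`q, q'` with `Σ|q_{ij}|, Σ|q'_{ij}| ≤ ½` (the segment between them is elliptic; `TuningParameterSegment`).
[cite: AdamsBuchholzKoteckyMuller2019, Theorem 6.1 (iv) / Lemma 12.6 (12.51)] -/
theorem abs_gradCov_one_add_sub_le_of_torusFRD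
    {𝒞 : Matrix (Fin d) (Fin d) ℝ → ℕ → (Fin d → ZMod M) → ℝ} {Cα : (Fin d → ℕ) → ℕ → ℝ} {L N n : ℕ}
    (hiv : ∀ A : Matrix (Fin d) (Fin d) ℝ, IsElliptic (1 / 2 : ℝ) 2 A →
      ∀ k, 1 ≤ k → k ≤ N + 1 → ∀ B : Matrix (Fin d) (Fin d) ℝ, IsUnitSymm B →
        (∃ ε : ℝ, 0 < ε ∧ ∀ x : Fin d → ZMod M,
          ContDiffOn ℝ ⊤ (fun s : ℝ => 𝒞 (A + s • B) k x) (Set.Ioo (-ε) ε)) ∧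
        ∀ α : Fin d → ℕ, ∑ i, α i ≤ n → ∀ ℓ : ℕ, ∀ x : Fin d → ZMod M,
          abs (iteratedDeriv ℓ (fun s : ℝ => iterDiff α (𝒞 (A + s • B) k) x) 0)
            ≤ Cα α ℓ / (L : ℝ) ^ ((k - 1) * (d - 2 + ∑ i, α i)))
    (hd : 2 ≤ d) (hn : 2 ≤ n) (hL : 1 ≤ L)
    {q q' : Matrix (Fin d) (Fin d) ℝ} (hq : q.IsSymm) (hq' : q'.IsSymm)
    (hq2 : ∑ i, ∑ j, |q i j| ≤ 1 / 2) (hq'2 : ∑ i, ∑ j, |q' i j| ≤ 1 / 2)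
    {k : ℕ} (hkN : k + 1 ≤ N + 1) (p : quadIndex d) :
    ((L ^ (d * k) : ℕ) : ℝ) *
        |gradCov (𝒞 ((1 : Matrix (Fin d) (Fin d) ℝ) + q') (k + 1)) p -
          gradCov (𝒞 ((1 : Matrix (Fin d) (Fin d) ℝ) + q) (k + 1)) p| ≤
      secondDiffConst (fun α => Cα α 1) * ∑ i, ∑ j, |(q' - q) i j| := by
  set T := ∑ i, ∑ j, |(q' - q) i j| with hTdef
  have hT0 : 0 ≤ T := sum_nonneg fun _ _ => sum_nonneg fun _ _ => abs_nonneg _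
  have hpow : ((L ^ (d * k) : ℕ) : ℝ) = (L : ℝ) ^ ((k + 1 - 1) * d) := by
    rw [Nat.add_sub_cancel, mul_comm]; push_cast; rfl
  rcases hT0.eq_or_lt with hT | hT
  · have hqq : q' = q := by
      have hz : q' - q = 0 := by
        ext i j
        have hle : |(q' - q) i j| ≤ T :=
          (single_le_sum (f := fun j => |(q' - q) i j|) (fun _ _ => abs_nonneg _) (mem_univ j)).trans
            (single_le_sum (f := fun i => ∑ j, |(q' - q) i j|)
              (fun _ _ => sum_nonneg fun _ _ => abs_nonneg _) (mem_univ i))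
        have : |(q' - q) i j| = 0 := le_antisymm (hT ▸ hle) (abs_nonneg _)
        simpa using this
      exact sub_eq_zero.1 hz
    rw [hqq, sub_self, abs_zero, mul_zero, ← hT, mul_zero]
  · set B : Matrix (Fin d) (Fin d) ℝ := T⁻¹ • (q' - q) with hBdef
    have hBu : IsUnitSymm B := isUnitSymm_direction hq hq' hT le_rfl
    have hell : ∀ t ∈ Icc (0 : ℝ) T,
        IsElliptic (1 / 2 : ℝ) 2 ((1 : Matrix (Fin d) (Fin d) ℝ) + q + t • B) :=
      isElliptic_segment_of_entrySum_le hq hq' hq2 hq'2 hT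
    have hend : (1 : Matrix (Fin d) (Fin d) ℝ) + q + T • B = 1 + q' := segment_end hT.ne'
    have h := abs_gradCov_segment_sub_le_of_torusFRD hiv hd hn hL hBu hT0 hell (k := k + 1) (by omega) hkN p
    rw [hend, ← hpow] at h
    exact h

section Package

variable {L N Mord R n ñ : ℕ} {θbar lam μ δ₁ δ₀ A𝒫 : ℝ}
    {𝒞 : Matrix (Fin d) (Fin d) ℝ → ℕ → (Fin d → ZMod M) → ℝ} {Mc : ℕ → ℝ}
    {Cα : (Fin d → ℕ) → ℕ → ℝ} {c C : ℝ} {Cℓ : ℕ → ℝ}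

/-- **The extracted Hamiltonian is Lipschitz in the tuning parameter** (scale-`k` weights): for one
`TorusFRD` package, symmetric `q, q'` with `Σ|q_{ij}|, Σ|q'_{ij}| ≤ ½`, `k + 1 ≤ N`, `L ≥ 2^{d+3}+16R`,
`‖nextH (abkmStepData L R k 𝒞s_{q'}) H K − nextH (abkmStepData L R k 𝒞s_q) H K‖_{k,0}
   ≤ (secondDiffConst(C_{·,1})·Σ|q'−q| / h²)·‖H‖_{k,0} + ‖opB (…q') K − opB (…q) K‖_{k,0}`.
[cite: AdamsBuchholzKoteckyMuller2019, Lemma 12.6 (12.51)–(12.52)] -/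
theorem hamNorm_nextH_sub_of_torusFRD
    (hd : 3 ≤ d) (hLodd : Odd L) (hL : 2 ^ (d + 3) + 16 * R ≤ L) (hM : M = L ^ N) (hn2 : 2 ≤ n)
    (hc : 0 < c)
    (hallA : ∀ A : Matrix (Fin d) (Fin d) ℝ, IsElliptic (1 / 2 : ℝ) 2 A →
        (∀ k, 1 ≤ k → k ≤ N + 1 →
          ∑ x : Fin d → ZMod M, 𝒞 A k x = 0 ∧ ∀ x, 𝒞 A k (-x) = 𝒞 A k x) ∧
        (∀ k, 1 ≤ k → k ≤ N + 1 → ∀ φ : (Fin d → ZMod M) → ℝ, ∑ x, φ x = 0 →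
          0 ≤ ∑ x, ∑ y, φ x * 𝒞 A k (x - y) * φ y) ∧
        (∀ φ : (Fin d → ZMod M) → ℝ, ∑ x, φ x = 0 →
          ellOp A (conv (fun x => ∑ k ∈ Finset.Icc 1 (N + 1), 𝒞 A k x) φ) = φ) ∧
        (∀ k, 1 ≤ k → k ≤ N → Mc k ≤ 0 ∧
          ∀ x : Fin d → ZMod M, ((L : ℝ) ^ k) / 2 ≤ (supNorm x : ℝ) →
            𝒞 A k x = Mc k) ∧
        (∀ k, 1 ≤ k → k ≤ N + 1 → ∀ B : Matrix (Fin d) (Fin d) ℝ, IsUnitSymm B →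
          (∃ ε : ℝ, 0 < ε ∧ ∀ x : Fin d → ZMod M,
            ContDiffOn ℝ ⊤ (fun s : ℝ => 𝒞 (A + s • B) k x) (Set.Ioo (-ε) ε)) ∧
          ∀ α : Fin d → ℕ, ∑ i, α i ≤ n → ∀ ℓ : ℕ, ∀ x : Fin d → ZMod M,
            abs (iteratedDeriv ℓ (fun s : ℝ => iterDiff α (𝒞 (A + s • B) k) x) 0)
              ≤ Cα α ℓ / (L : ℝ) ^ ((k - 1) * (d - 2 + ∑ i, α i))) ∧
        (∀ k, 1 ≤ k → k ≤ N + 1 → ∀ j : ℕ, ∀ κ : Fin d → ZMod M, κ ≠ 0 → InShell L j κ →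
          (j < k →
            c / (L : ℝ) ^ (2 * (d + ñ) + 1) * (L : ℝ) ^ (2 * j)
                / (L : ℝ) ^ ((k - j) * (d - 1 + n)) ≤ (fourierCoeff (𝒞 A k) κ).re ∧
            ‖fourierCoeff (𝒞 A k) κ‖
              ≤ C * (L : ℝ) ^ (2 * (d + ñ) + 1) * (L : ℝ) ^ (2 * j)
                  / (L : ℝ) ^ ((k - j) * (d - 1 + n))) ∧
          (k ≤ j →
            c / (L : ℝ) ^ (2 * (d + ñ) + 1) * (L : ℝ) ^ (2 * k)
                ≤ (fourierCoeff (𝒞 A k) κ).re ∧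
            ‖fourierCoeff (𝒞 A k) κ‖ ≤ C * (L : ℝ) ^ (2 * k)) ∧
          ∀ B : Matrix (Fin d) (Fin d) ℝ, IsUnitSymm B → ∀ ℓ : ℕ, 1 ≤ ℓ →
            (j < k →
              ‖iteratedDeriv ℓ (fun s : ℝ => fourierCoeff (𝒞 (A + s • B) k) κ) 0‖
                ≤ Cℓ ℓ * (L : ℝ) ^ (2 * (d + ñ) + 1) * (L : ℝ) ^ (2 * j)
                    / (L : ℝ) ^ ((k - j) * (d - 1 + ñ))) ∧
            (k ≤ j →
              ‖iteratedDeriv ℓ (fun s : ℝ => fourierCoeff (𝒞 (A + s • B) k) κ) 0‖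
                ≤ Cℓ ℓ * (L : ℝ) ^ (2 * k))))
    {k : ℕ} (hkN : k + 1 ≤ N) {p : ℕ} (hpR : p ≤ R) (hp : d / 2 + 1 ≤ p) {h : ℝ} (hh : 0 < h)
    {q q' : Matrix (Fin d) (Fin d) ℝ} (hq : q.IsSymm) (hq' : q'.IsSymm)
    (hq2 : ∑ i, ∑ j, |q i j| ≤ 1 / 2) (hq'2 : ∑ i, ∑ j, |q' i j| ≤ 1 / 2)
    (H : RelevantHamiltonian ℂ d) (K : Finset (Fin d → ZMod M) → ((Fin d → ZMod M) → ℝ) → ℂ) :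
    hamNorm (fieldWt h L d k) ((L : ℝ) ^ k) (L ^ (d * k))
        (nextH (abkmStepData L R k fun j => 𝒞 ((1 : Matrix (Fin d) (Fin d) ℝ) + q') j) H K -
          nextH (abkmStepData L R k fun j => 𝒞 ((1 : Matrix (Fin d) (Fin d) ℝ) + q) j) H K) ≤
      (secondDiffConst (fun α => Cα α 1) * (∑ i, ∑ j, |(q' - q) i j|) / h ^ 2) *
          hamNorm (fieldWt h L d k) ((L : ℝ) ^ k) (L ^ (d * k)) H +
        hamNorm (fieldWt h L d k) ((L : ℝ) ^ k) (L ^ (d * k))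
          (opB (abkmStepData L R k fun j => 𝒞 ((1 : Matrix (Fin d) (Fin d) ℝ) + q') j) K -
            opB (abkmStepData L R k fun j => 𝒞 ((1 : Matrix (Fin d) (Fin d) ℝ) + q) j) K) := by
  have h8 : 8 ≤ 2 ^ (d + 3) := by
    calc 8 = 2 ^ 3 := by norm_num
      _ ≤ 2 ^ (d + 3) := Nat.pow_le_pow_right (by norm_num) (by omega)
  have hL2 : 2 ≤ L := by omega
  have hL1 : 1 ≤ L := by omega
  have hd2 : 2 ≤ d := by omega
  have hk : k + 1 ≤ N + 1 := by omega
  have hellq : IsElliptic (1 / 2 : ℝ) 2 ((1 : Matrix (Fin d) (Fin d) ℝ) + q) :=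
    isElliptic_one_add_of_entrySum_le hq hq2
  have hellq' : IsElliptic (1 / 2 : ℝ) 2 ((1 : Matrix (Fin d) (Fin d) ℝ) + q') :=
    isElliptic_one_add_of_entrySum_le hq' hq'2
  set Da := abkmStepData L R k fun j => 𝒞 ((1 : Matrix (Fin d) (Fin d) ℝ) + q') j with hDa
  set Db := abkmStepData L R k fun j => 𝒞 ((1 : Matrix (Fin d) (Fin d) ℝ) + q) j with hDb
  -- positivity of the two circulants (even kernels with non-negative multipliers)
  have hpsd : ∀ {A : Matrix (Fin d) (Fin d) ℝ}, IsElliptic (1 / 2 : ℝ) 2 A →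
      (Matrix.circulant (𝒞 A (k + 1))).PosSemidef := by
    intro A hA
    have hqA := hallA A hA
    have heven : ∀ x, 𝒞 A (k + 1) (-x) = 𝒞 A (k + 1) x := (hqA.1 (k + 1) (by omega) hk).2
    rw [GradientFRD.circulant_eq_mulMat heven]
    exact GradientFRD.posSemidef_mulMat fun κ =>
      re_fourierCoeff_nonneg_of_torusFRD hqA.1 hqA.2.2.2.2.2 hc hL2 (by omega) hk κ
  have hCa : (Matrix.circulant Da.𝒞).PosSemidef := hpsd hellq'
  have hCb : (Matrix.circulant Db.𝒞).PosSemidef := hpsd hellq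
  -- the reference block and the room for the test polynomials
  obtain ⟨t, ht⟩ : ∃ t, N = k + t := ⟨N - k, by omega⟩
  have hMt0 : M = L ^ k * L ^ t := by rw [← pow_add, ← ht]; exact hM
  have htodd : Odd (L ^ t) := hLodd.pow
  have hB₀ : Da.B₀ = blockOf (L ^ k) 0 := rfl
  have hc₀ : Da.c₀ = boxCorner (L ^ k) (starRad R L d k) 0 := rfl
  have hB : Da.B₀.card ≠ 0 := by
    rw [hB₀]; exact (card_pos.2 ⟨0, TorusPolymer.mem_blockOf_self _ 0⟩).ne'
  obtain ⟨hwrap0, hroom0⟩ := abkm_box_lt (d := d) hL hpR hkN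
  have hwrap : 4 * ((L ^ k - 1) / 2 + starRad R L d k) < M := by rw [hM]; exact hwrap0
  have hroom : ∀ x ∈ Da.B₀, HasRoom Da.c₀ x (d / 2 + 1) := by
    intro x hx
    have hxS : x ∈ TorusPolymer.thicken (starRad R L d k) (blockOf (L ^ k) 0) := by
      rw [← hB₀]; exact TorusPolymer.subset_thicken _ _ hx
    have hin := (TorusPolymer.mem_thicken_blockOf_iff_inBox hMt0 hLodd.pow htodd hwrap 0 x).1 hxS
    rw [hc₀]
    refine TorusPolymer.hasRoom_of_inBox hin ?_
    have h2 : ((2 * ((L ^ k - 1) / 2 + starRad R L d k) : ℕ) + ((d / 2 + 1 : ℕ) : ℤ)) * 2 < (M : ℤ) := by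
      have : (2 * ((L ^ k - 1) / 2 + starRad R L d k) + (d / 2 + 1)) * 2 < M := by
        rw [hM]; have := hroom0; omega
      exact_mod_cast this
    exact_mod_cast h2
  -- the `γ`-closeness
  have hγ : ∀ pq : quadIndex d, ((L ^ (d * k) : ℕ) : ℝ) * |gradCov Da.𝒞 pq - gradCov Db.𝒞 pq| ≤
      secondDiffConst (fun α => Cα α 1) * ∑ i, ∑ j, |(q' - q) i j| := fun pq =>
    abs_gradCov_one_add_sub_le_of_torusFRD (fun A hA => (hallA A hA).2.2.2.2.1) hd2 hn2 hL1 hq hq' hq2 hq'2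
      hk pq
  have hδ : 0 ≤ secondDiffConst (fun α => Cα α 1) * ∑ i, ∑ j, |(q' - q) i j| := by
    have h1 := hγ ⟨(⟨0, by omega⟩, ⟨0, by omega⟩), by simp⟩
    exact le_trans (by positivity) h1
  exact hamNorm_nextH_kernel_sub_le hd2 hL1 hh hδ k Da Db hCa hCb hB hroom rfl rfl hγ H K

end Package

end Literature.MathematicalPhysics.StatisticalMechanics.GradientRG

end
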